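import Summits.NavierStokesRegularity.FluidComputer.GateBudgetSwingPrice
import HarnessLib

/-!
# GateBudget part 105 — the swing transfer, V: the pulse ceiling at `k = 1` (§287)

Cell `pub-fluidc`, blueprint seat bp1 (gen 38); namespace
`Summit.NavierStokesRegularity.FluidComputer.GateBudget`, headline family
`RotorKnob.rotorCircuit K K¹⁰ ε ρ` from `delayInit` (`K ≥ 16`) on the UNIT lattice
`ε = K¹⁰ρ²`. HONEST FRAMING: a low prior, high value-of-information experiment on Tao's
machine paradigm; NOT a claim that NS blows up. Nothing here is about the Navier–Stokes
equations: these are inequalities about the five-mode toy circuit (5.5)/(5.6).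

* §287 `knob_pulse_ceiling_swing` — THE PULSE CEILING WITH THE SWING PRICE. Same pulse as
  part 75 §226 (ignition `b(r) = θε`, `5/4 ≤ θ ≤ 3/2`, `c(r) = ρ²/K⁹`, kept ring, `c > 0`,
  duration `≤ 242/K⁹` and `≤ 241 log K/K¹⁰`, exit `b(T') ≤ -(31/32)θε`, exit phase
  `|Φ(T') - π| ≤ δ`) at `k = 1`, plus `a(r) ≠ 0`:
  `ã(T') - ã(r) ≤ (1.57·a(r)² + 3.33·(|d(r)| + d(r)²) + 1/4 + (520d(r)² + 1500δ²)log K)/K⁹`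
  against part 75's `(7/2 + 1/4 + 520d(r)²log K + 1500δ²log K)/K⁹`.
  Assembly: part 100 §277 `pulse_swing_band` supplies the band times `r < t₁ < t₂ ≤ T'`
  (`b(t₁) = (31/32)θε = -b(t₂)`, the climb band, the swing band, the fall `b ≤ -(15/16)θε`,
  the two-sided ring, `c(tᵢ)² ≤ θ²ε²/16`, the climb dwell and the dose sandwich); the climb
  is part 74 §224 `leak_climb` and the fall §225 `leak_fall` priced EXACTLY as in part 75
  (`0.056 + 0.183` for the `k²`-terms at `k = 1`, `32·d(r)²·log K` for the climb pair term
  since `log(c(t₁)/c(r)) ≤ 19 log K`, `(482d(r)² + 1446δ²)log K` and `0.0035` on the fall,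
  `0.0015` drift); the swing is part 104 §286 `swing_headline_price`,
  `(1 + 2/10⁴)·a(r)²/(θK⁹)·(1.96 + 4.16E)` with `E·a(r)² = |d(r)| + d(r)² + 6L(T' - r)`,
  `L = ε + ρ²e^{-K¹⁰} + Kã(T') ≤ (9/8)K`, `6L(T' - r) ≤ 1633.5/K⁸ ≤ 10⁻⁴`, and
  `(1 + 2/10⁴)/θ ≤ 0.80016`: `1.5684a(r)² + 3.3287(|d(r)| + d(r)²) + 0.0004`, replacing the
  crude `K(t₂ - t₁) ≤ 3.33/K⁹` of part 75 (`output_step_le`).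

WHAT THIS SAYS (and does not). On the ladder (`a(r)² ≤ 1`, `|d(r)| ≤ D` small) the per-rung
leak ceiling drops from part 76's `U = 7/2 + 1/3 = 3.83` (at `k = 1`) to
`U₁ ≤ 1.57 + 0.25 + 3.33(D + D²) + (pin terms) ≈ 1.82`; the floor of part 71 §217 is `1/K⁹`.
The clean dud horizon re-run (part 98 with `U₁`) is part 106 and remains a FORECAST
(`≈ 0.07K⁹` at `K = 16` against today's `0.0343K⁹`, necessity ceiling `0.1415K⁹ + 1`) until
filed. HONEST LIMITS: (i) `k = 1` only; (ii) `a(r) ≠ 0` is a hypothesis (the ladder has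
`a(r)² ≥ 1 - P ≥ 0.9`); (iii) the constants `1/4` and `520` carry part 75's slack; (iv) no
matching phase-resolved floor (the method's truth is `2cos α₁ ≈ 1.94` per unit `a(r)²/θ`);
(v) nothing about NS.
[cite: Tao2016AveragedNS, §5.5 Theorem 5.3, (5.5), (b-eq), (c-eq), (d-eq), (energy-con)]
-/

noncomputable section

namespace Summit.NavierStokesRegularity.FluidComputer.GateBudget

open Real Set Filter Topology
open Literature.Analysis.FluidPDE.Tao2016AveragedNS

variable {K M ε ρ : ℝ} {X : ℝ → Fin 5 → ℝ} {C : ℝ → ℝ}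

/-! ## §287 The pulse ceiling with the swing price -/

set_option maxHeartbeats 400000 in
/-- §287 THE PULSE CEILING WITH THE SWING PRICE (headline member, `K ≥ 16`, unit lattice
`ε = K¹⁰ρ²`). For a pulse on `[r, T']` (`r ≥ 0`) igniting at `b(r) = θε`, `5/4 ≤ θ ≤ 3/2`,
`c(r) = ρ²/K⁹`, `a(r) ≠ 0`, staying in the kept ring with `c > 0`, of duration
`T' - r ≤ 242/K⁹` and `≤ 241 log K/K¹⁰`, ending with `b(T') ≤ -(31/32)θε` and exit phase
`|Φ(T') - π| ≤ δ`:
`ã(T') - ã(r) ≤ (1.57a(r)² + 3.33(|d(r)| + d(r)²) + 1/4 + (520d(r)² + 1500δ²)log K)/K⁹`.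
[derived: part 100 §277, part 74 §224/§225, part 104 §286, part 75 §226 (bookkeeping)] -/
theorem knob_pulse_ceiling_swing
    (hX : ∀ t, HasDerivAt X (RotorKnob.rotorCircuit K (K ^ 10) ε ρ (X t)) t)
    (h0 : X 0 = delayInit) (hC : ∀ t, HasDerivAt C (X t 2) t) (hK : 16 ≤ K) (hε : 0 < ε)
    (hρ : 0 < ρ) (hlat : ε = K ^ 10 * ρ ^ 2) {r T' θ δ : ℝ} (hr : 0 ≤ r) (hrT : r ≤ T')
    (hτ : T' - r ≤ 242 / K ^ 9) (hτ' : T' - r ≤ 241 * log K / K ^ 10) (hθ1 : 5 / 4 ≤ θ)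
    (hθ2 : θ ≤ 3 / 2) (ha : X r 0 ≠ 0) (hbr : X r 1 = θ * ε) (hcr : X r 2 = ρ ^ 2 / K ^ 9)
    (hkept : ∀ t ∈ Icc r T', |X t 1 ^ 2 + X t 2 ^ 2 - (X r 1 ^ 2 + X r 2 ^ 2)| ≤ ε ^ 2 / 10 ^ 6)
    (hpos : ∀ t ∈ Icc r T', 0 < X t 2) (hbT : X T' 1 ≤ -(31 / 32 * θ * ε))
    (hpin : |(C T' - C r) / ρ ^ 2 - π| ≤ δ) :
    X T' 4 - X r 4 ≤ (157 / 100 * X r 0 ^ 2 + 333 / 100 * (|X r 3| + X r 3 ^ 2) + 1 / 4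
      + (520 * X r 3 ^ 2 + 1500 * δ ^ 2) * log K) / K ^ 9 := by
  have hK0 : (0 : ℝ) < K := by linarith
  have hK1 : (1 : ℝ) ≤ K := by linarith
  have hK10 : (16 : ℝ) ^ 10 ≤ K ^ 10 := pow_le_pow_left₀ (by norm_num) hK 10
  have hk : ε = ((1 : ℕ) : ℝ) * K ^ 10 * ρ ^ 2 := by rw [hlat]; push_cast; ring
  have hKρ0 : 0 ≤ K ^ 10 * ρ ^ 2 := by positivity
  have hhi : K ^ 10 * ρ ^ 2 ≤ 2 * ε := by rw [hlat]; linarith only [hKρ0]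
  have hlogK : 0 ≤ log K := log_nonneg hK1
  have hθ0 : 0 < θ := by linarith
  have hθi : θ⁻¹ ≤ 4 / 5 := by rw [inv_le_comm₀ hθ0 (by norm_num)]; linarith only [hθ1]
  have hτ0 : 0 ≤ T' - r := by linarith
  have hε1 : ε ≤ 4 / 5 := by
    have hb1 := (abs_le.1 (RotorKnob.traj_abs_le_one hX h0 r 1)).2
    rw [hbr] at hb1
    nlinarith only [hb1, hθ1, hε]
  have hρε : ρ ^ 2 ≤ ε := by
    rw [hlat]; nlinarith only [one_le_pow₀ hK1 (n := 10), sq_nonneg ρ]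
  have hρk : ρ ^ 2 = ε / K ^ 10 := by rw [hlat]; field_simp
  have hexp1 : exp (-K ^ 10) ≤ 1 := exp_le_one_iff.2 (by simp [pow_nonneg hK0.le])
  -- the band times (part 100 §277)
  obtain ⟨t₁, t₂, hrt₁, ht₁₂, ht₂T, hb1, hb2, hcl, hband, hbfall, hring, hc1, hc2, hclimb,
    hdlo, hdhi⟩ := pulse_swing_band hX h0 hC hK hε hρ hhi hrT hτ hθ1 hbr hcr hkept hpos hbT
  have hrt₂ : r ≤ t₂ := hrt₁.le.trans ht₁₂.le
  have ht₁T : t₁ ≤ T' := ht₁₂.le.trans ht₂T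
  -- (1) the climb law (part 74 §224), (2) the swing price (part 104 §286), (3) the fall law
  have hΔ1 := leak_climb hX h0 hC hK0.le hε 1 hk hr hrt₁.le ht₁T
    (by positivity : (0 : ℝ) < 31 / 32 * θ * ε) (fun u hu => (hcl u hu).1)
  have hΔ2 := swing_headline_price hX h0 hC hK hε hlat hr hrt₁.le ht₁₂.le ht₂T hτ hθ1 ha hcr
    hring hpos hb1 hb2 hband hdlo hdhi rfl
  have hc2ε : ∀ u ∈ Icc t₂ T', X u 2 ≤ 2 * ε := by
    intro u hu
    have huI : u ∈ Icc r T' := ⟨hrt₂.trans hu.1, hu.2⟩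
    have hringu := (abs_le.1 (hkept u huI)).2
    rw [hbr, hcr] at hringu
    have h1 : (ρ ^ 2 / K ^ 9) ^ 2 ≤ ε ^ 2 :=
      pow_le_pow_left₀ (by positivity)
        ((div_le_self (sq_nonneg ρ) (one_le_pow₀ hK1)).trans hρε) 2
    have h2 : (θ * ε) ^ 2 ≤ (3 / 2 * ε) ^ 2 :=
      pow_le_pow_left₀ (by positivity) (by nlinarith only [hθ2, hε]) 2
    have h3 : X u 2 ^ 2 ≤ (2 * ε) ^ 2 := by
      nlinarith only [hringu, h1, h2, sq_nonneg (X u 1), hε]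
    exact (abs_le_of_sq_le_sq' h3 (by positivity)).2
  have hpin' : |(C T' - C r) / ρ ^ 2 - ((1 : ℕ) : ℝ) * π| ≤ δ := by simpa using hpin
  have hΔ3 := leak_fall hX h0 hC hK0.le hε 1 hk hr hrt₂ ht₂T
    (by positivity : (0 : ℝ) < 15 / 16 * θ * ε) hbfall hc2ε hpin'
  simp only [Nat.cast_one, one_pow, mul_one, one_mul] at hΔ1 hΔ3
  -- names
  obtain ⟨L, hL⟩ : ∃ L : ℝ, L = ε + ρ ^ 2 * exp (-K ^ 10) + K * X T' 4 := ⟨_, rfl⟩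
  obtain ⟨κ₁, hκ₁⟩ : ∃ κ₁ : ℝ, κ₁ = K * ε / (K ^ 10 * (31 / 32 * θ * ε) ^ 3) := ⟨_, rfl⟩
  obtain ⟨κ₂, hκ₂⟩ : ∃ κ₂ : ℝ, κ₂ = K * ε / (K ^ 10 * (15 / 16 * θ * ε) ^ 3) := ⟨_, rfl⟩
  obtain ⟨σ, hσ⟩ : ∃ σ : ℝ, σ = ρ ^ 2 * exp (-K ^ 10) := ⟨_, rfl⟩
  obtain ⟨ξ, hξ⟩ : ∃ ξ : ℝ, ξ = σ * (T' - r) / (15 / 16 * θ * ε) := ⟨_, rfl⟩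
  obtain ⟨W, hW⟩ : ∃ W : ℝ, W = |X r 3| + X r 3 ^ 2 := ⟨_, rfl⟩
  rw [← hL, ← hκ₁] at hΔ1
  rw [← hL] at hΔ2
  rw [← hL, ← hκ₂, ← hσ, ← hξ] at hΔ3
  have hσ0 : 0 ≤ σ := by rw [hσ]; positivity
  have hσρ : σ ≤ ρ ^ 2 := by
    rw [hσ]; exact (mul_le_mul_of_nonneg_left hexp1 (sq_nonneg ρ)).trans (mul_one _).le
  have hκ₁0 : 0 ≤ κ₁ := by rw [hκ₁]; positivity
  have hκ₂0 : 0 ≤ κ₂ := by rw [hκ₂]; positivity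
  have hd0 := sq_nonneg (X r 3)
  have hW0 : 0 ≤ W := by rw [hW]; positivity
  -- (B1) climb k²-term, (B5) fall k²-term (k = 1)
  have hB1 : κ₁ * (X t₁ 2 ^ 2 - X r 2 ^ 2) ≤ 0.056 / K ^ 9 := by
    have e1 : κ₁ * (X t₁ 2 ^ 2 - X r 2 ^ 2) ≤ κ₁ * (θ ^ 2 * ε ^ 2 / 16) :=
      mul_le_mul_of_nonneg_left (by nlinarith only [hc1, sq_nonneg (X r 2)]) hκ₁0
    have e2 : κ₁ * (θ ^ 2 * ε ^ 2 / 16) = 2048 / 29791 * θ⁻¹ / K ^ 9 := by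
      rw [hκ₁]; field_simp; ring
    have e3 : 2048 / 29791 * θ⁻¹ / K ^ 9 ≤ 0.056 / K ^ 9 :=
      div_le_div_of_nonneg_right (by nlinarith only [hθi]) (by positivity)
    linarith only [e1, e2.le, e3]
  have hB5 : 3 * κ₂ * X t₂ 2 ^ 2 ≤ 0.183 / K ^ 9 := by
    have e1 : 3 * κ₂ * X t₂ 2 ^ 2 ≤ 3 * κ₂ * (θ ^ 2 * ε ^ 2 / 16) :=
      mul_le_mul_of_nonneg_left hc2 (by positivity)
    have e2 : 3 * κ₂ * (θ ^ 2 * ε ^ 2 / 16) = 768 / 3375 * θ⁻¹ / K ^ 9 := by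
      rw [hκ₂]; field_simp; ring
    have e3 : 768 / 3375 * θ⁻¹ / K ^ 9 ≤ 0.183 / K ^ 9 :=
      div_le_div_of_nonneg_right (by nlinarith only [hθi]) (by positivity)
    linarith only [e1, e2.le, e3]
  -- (B2) the pair term of the climb: `2Kd(r)²(t₁ - r) ≤ 32 d(r)² log K/K⁹`
  have hc1pos : 0 < X t₁ 2 := hpos t₁ ⟨hrt₁.le, ht₁T⟩
  have hcrpos : 0 < X r 2 := hpos r ⟨le_rfl, hrT⟩
  have hlog : log (X t₁ 2) - log (X r 2) ≤ 19 * log K := by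
    have hc1le : X t₁ 2 ≤ ε := by
      have h := (abs_le_of_sq_le_sq' (by nlinarith only [hc1] : X t₁ 2 ^ 2 ≤ (θ * ε / 4) ^ 2)
        (by positivity)).2
      nlinarith only [h, hθ2, hε]
    have hratio : X t₁ 2 / X r 2 ≤ K ^ 19 := by
      rw [div_le_iff₀ hcrpos, hcr]
      have e : K ^ 19 * (ρ ^ 2 / K ^ 9) = ε := by rw [hlat]; field_simp
      rw [e]; exact hc1le
    rw [← log_div hc1pos.ne' hcrpos.ne']
    calc log (X t₁ 2 / X r 2) ≤ log (K ^ 19) := log_le_log (by positivity) hratio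
      _ = 19 * log K := by rw [log_pow]; push_cast; ring
  have hB2 : 2 * K * X r 3 ^ 2 * (t₁ - r) ≤ 32 * X r 3 ^ 2 * log K / K ^ 9 := by
    have e1 : t₁ - r ≤ 32 * (19 * log K) / (31 * θ * K ^ 10) :=
      hclimb.trans (div_le_div_of_nonneg_right (by linarith only [hlog]) (by positivity))
    have e2 := mul_le_mul_of_nonneg_left e1 (by positivity : (0 : ℝ) ≤ 2 * K * X r 3 ^ 2)
    have e3 : 2 * K * X r 3 ^ 2 * (32 * (19 * log K) / (31 * θ * K ^ 10))
        = 1216 / 31 * θ⁻¹ * (X r 3 ^ 2 * log K / K ^ 9) := by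
      field_simp; ring
    have e4 : 1216 / 31 * θ⁻¹ * (X r 3 ^ 2 * log K / K ^ 9)
        ≤ 32 * (X r 3 ^ 2 * log K / K ^ 9) :=
      mul_le_mul_of_nonneg_right (by nlinarith only [hθi]) (by positivity)
    have e5 : 32 * (X r 3 ^ 2 * log K / K ^ 9) = 32 * X r 3 ^ 2 * log K / K ^ 9 := by ring
    linarith only [e2, e3.le, e4, e5.le]
  -- (B3/B9) the drift `6KL(T' - r)² ≤ 0.0015/K⁹`
  have hL98 : L ≤ 9 / 8 * K := by
    have hae := (abs_le.1 (RotorKnob.traj_abs_le_one hX h0 T' 4)).2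
    rw [hL, ← hσ]
    nlinarith only [hae, hε1, hσρ, hρε, hK, hK0]
  have hL0 : 0 ≤ L := by
    rw [hL]; have := RotorKnob.e_nonneg hX h0 hK0.le (hr.trans hrT); positivity
  have hdrift : 6 * K * L * (T' - r) * (T' - r) ≤ 0.0015 / K ^ 9 := by
    have e1 : 6 * K * L * (T' - r) * (T' - r)
        ≤ 6 * K * (9 / 8 * K) * (242 / K ^ 9) * (242 / K ^ 9) := by
      have := mul_le_mul hτ hτ hτ0 (by positivity)
      have := mul_le_mul hL98 this (by positivity) (by positivity)
      nlinarith only [this, hK0]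
    refine e1.trans ?_
    rw [show 6 * K * (9 / 8 * K) * (242 / K ^ 9) * (242 / K ^ 9)
        = 395307 * K ^ 2 / (K ^ 9 * K ^ 9) by field_simp; ring,
      div_le_div_iff₀ (by positivity) (by positivity)]
    have h7 : (16 : ℝ) ^ 7 ≤ K ^ 7 := pow_le_pow_left₀ (by norm_num) hK 7
    nlinarith only [h7, pow_pos hK0 11]
  have hB3 : 6 * K * L * (T' - r) * (t₁ - r) ≤ 0.0015 / K ^ 9 :=
    (mul_le_mul_of_nonneg_left (by linarith only [ht₁T]) (by positivity)).trans hdrift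
  -- (B4) THE SWING PRICE: `≤ (1.57a(r)² + 3.33W + 0.0005)/K⁹` (part 104 §286)
  have hG : 6 * L * (T' - r) ≤ 1 / 10 ^ 4 := by
    have e1 : 6 * L * (T' - r) ≤ 6 * (9 / 8 * K) * (242 / K ^ 9) :=
      mul_le_mul (mul_le_mul_of_nonneg_left hL98 (by norm_num)) hτ hτ0 (by positivity)
    refine e1.trans ?_
    rw [show 6 * (9 / 8 * K) * (242 / K ^ 9) = 3267 / 2 * K / K ^ 9 by field_simp; ring,
      div_le_iff₀ (by positivity)]
    have h8 : (16 : ℝ) ^ 8 ≤ K ^ 8 := pow_le_pow_left₀ (by norm_num) hK 8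
    have h9 : K * 16 ^ 8 ≤ K * K ^ 8 := mul_le_mul_of_nonneg_left h8 hK0.le
    have h10 : K * K ^ 8 = K ^ 9 := by ring
    nlinarith only [h9, h10, hK0]
  have ha2 : 0 < X r 0 ^ 2 := lt_of_le_of_ne (sq_nonneg _) (Ne.symm (pow_ne_zero 2 ha))
  have hB4 : (1 + 2 / 10 ^ 4) * X r 0 ^ 2 / (θ * K ^ 9)
        * (196 / 100 + 416 / 100 * ((|X r 3| + X r 3 ^ 2 + 6 * L * (T' - r)) / X r 0 ^ 2))
      ≤ (157 / 100 * X r 0 ^ 2 + 333 / 100 * W + 0.0005) / K ^ 9 := by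
    rw [← hW]
    have e1 : (1 + 2 / 10 ^ 4) * X r 0 ^ 2 / (θ * K ^ 9)
          * (196 / 100 + 416 / 100 * ((W + 6 * L * (T' - r)) / X r 0 ^ 2))
        = (1 + 2 / 10 ^ 4) * θ⁻¹
          * (196 / 100 * X r 0 ^ 2 + 416 / 100 * W + 416 / 100 * (6 * L * (T' - r)))
          / K ^ 9 := by
      field_simp
      ring
    rw [e1]
    refine div_le_div_of_nonneg_right ?_ (by positivity)
    have hφ : (1 + 2 / 10 ^ 4) * θ⁻¹ ≤ 80016 / 100000 := by nlinarith only [hθi]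
    have hS0 : 0 ≤ 196 / 100 * X r 0 ^ 2 + 416 / 100 * W + 416 / 100 * (6 * L * (T' - r)) := by
      positivity
    have e2 := mul_le_mul_of_nonneg_right hφ hS0
    nlinarith only [e2, hG, ha2, hW0]
  -- (B6) pair and pin terms of the fall, (B7) `6Kξ²τ`, (B8) `12κ₂σετ` tiny
  have hB6 : K * (2 * X r 3 ^ 2 + 6 * δ ^ 2) * (T' - r)
      ≤ (482 * X r 3 ^ 2 + 1446 * δ ^ 2) * log K / K ^ 9 := by
    have e1 := mul_le_mul_of_nonneg_left hτ'
      (by positivity : (0 : ℝ) ≤ K * (2 * X r 3 ^ 2 + 6 * δ ^ 2))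
    have e2 : K * (2 * X r 3 ^ 2 + 6 * δ ^ 2) * (241 * log K / K ^ 10)
        = (482 * X r 3 ^ 2 + 1446 * δ ^ 2) * log K / K ^ 9 := by field_simp; ring
    linarith only [e1, e2.le]
  have hξ1 : ξ ≤ 1 / K ^ 10 := by
    rw [hξ, div_le_div_iff₀ (by positivity) (by positivity), one_mul]
    have e1 : σ * (T' - r) ≤ ρ ^ 2 * (T' - r) := mul_le_mul_of_nonneg_right hσρ hτ0
    have e3 : T' - r ≤ 1 := by
      refine hτ.trans ?_
      rw [div_le_one (by positivity)]
      nlinarith only [pow_le_pow_left₀ (by norm_num : (0 : ℝ) ≤ 16) hK 9]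
    have e4 : ε / K ^ 10 * (T' - r) * K ^ 10 ≤ 15 / 16 * θ * ε := by
      rw [div_mul_eq_mul_div, div_mul_cancel₀ _ (by positivity)]
      nlinarith only [e3, hθ1, hε, hτ0]
    calc σ * (T' - r) * K ^ 10 ≤ ρ ^ 2 * (T' - r) * K ^ 10 :=
          mul_le_mul_of_nonneg_right e1 (by positivity)
      _ = ε / K ^ 10 * (T' - r) * K ^ 10 := by rw [hρk]
      _ ≤ 15 / 16 * θ * ε := e4
  have hξ0 : 0 ≤ ξ := by rw [hξ]; positivity
  have hB7 : 6 * K * ξ ^ 2 * (T' - r) ≤ 0.001 / K ^ 9 := by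
    have e1 : ξ ^ 2 ≤ (1 / K ^ 10) ^ 2 := pow_le_pow_left₀ hξ0 hξ1 2
    have e2 : 6 * K * ξ ^ 2 * (T' - r) ≤ 6 * K * (1 / K ^ 10) ^ 2 * (242 / K ^ 9) := by
      have := mul_le_mul e1 hτ hτ0 (by positivity)
      nlinarith only [this, hK0]
    refine e2.trans ?_
    rw [show 6 * K * (1 / K ^ 10) ^ 2 * (242 / K ^ 9) = 1452 * K / (K ^ 20 * K ^ 9) by
        field_simp; ring, div_le_div_iff₀ (by positivity) (by positivity)]
    have h19 : (16 : ℝ) ^ 19 ≤ K ^ 19 := pow_le_pow_left₀ (by norm_num) hK 19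
    nlinarith only [h19, pow_pos hK0 10]
  have hB8 : 12 * κ₂ * σ * ε * (T' - r) ≤ 0.001 / K ^ 9 := by
    have e1 : κ₂ * ρ ^ 2 * ε = 4096 / 3375 * (θ ^ 3)⁻¹ * (K / K ^ 20) := by
      rw [hκ₂, hρk]; field_simp; ring
    have hθ3 : (θ ^ 3)⁻¹ ≤ 1 := inv_le_one_of_one_le₀ (one_le_pow₀ (by linarith only [hθ1]))
    have e2 : K / K ^ 20 ≤ 1 / (200 * K ^ 9) := by
      rw [div_le_div_iff₀ (by positivity) (by positivity)]
      nlinarith only [hK10, pow_pos hK0 10, hK0]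
    have e3 : κ₂ * ρ ^ 2 * ε ≤ 4096 / 3375 * 1 * (1 / (200 * K ^ 9)) := by
      rw [e1]; exact mul_le_mul (mul_le_mul_of_nonneg_left hθ3 (by norm_num)) e2
        (by positivity) (by positivity)
    have e4 : 12 * κ₂ * σ * ε * (T' - r) ≤ 12 * (κ₂ * ρ ^ 2 * ε) * (242 / K ^ 9) := by
      have := mul_le_mul (mul_le_mul_of_nonneg_left hσρ hκ₂0) hτ hτ0 (by positivity)
      nlinarith only [this, hε.le]
    refine e4.trans ?_
    have e5 : 12 * (κ₂ * ρ ^ 2 * ε) * (242 / K ^ 9)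
        ≤ 12 * (4096 / 3375 * 1 * (1 / (200 * K ^ 9))) * (242 / K ^ 9) :=
      mul_le_mul_of_nonneg_right (mul_le_mul_of_nonneg_left e3 (by norm_num)) (by positivity)
    refine e5.trans ?_
    rw [show 12 * (4096 / 3375 * 1 * (1 / (200 * (K : ℝ) ^ 9))) * (242 / K ^ 9)
        = 12 * 4096 * 242 / (3375 * 200) / (K ^ 9 * K ^ 9) by field_simp,
      div_le_div_iff₀ (by positivity) (by positivity)]
    have h9 : (16 : ℝ) ^ 9 ≤ K ^ 9 := pow_le_pow_left₀ (by norm_num) hK 9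
    nlinarith only [h9, pow_pos hK0 9]
  -- the fall bracket at `T' - t₂ ≤ T' - r`
  have hfall : (K * (2 * X r 3 ^ 2 + 6 * δ ^ 2 + 6 * ξ ^ 2) + 12 * κ₂ * σ * ε
        + 6 * K * L * (T' - r)) * (T' - t₂)
      ≤ (482 * X r 3 ^ 2 + 1446 * δ ^ 2) * log K / K ^ 9 + 0.001 / K ^ 9 + 0.001 / K ^ 9
        + 0.0015 / K ^ 9 := by
    have e1 : (K * (2 * X r 3 ^ 2 + 6 * δ ^ 2 + 6 * ξ ^ 2) + 12 * κ₂ * σ * ε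
          + 6 * K * L * (T' - r)) * (T' - t₂)
        ≤ (K * (2 * X r 3 ^ 2 + 6 * δ ^ 2 + 6 * ξ ^ 2) + 12 * κ₂ * σ * ε
          + 6 * K * L * (T' - r)) * (T' - r) :=
      mul_le_mul_of_nonneg_left (by linarith only [hrt₂]) (by positivity)
    have e2 : (K * (2 * X r 3 ^ 2 + 6 * δ ^ 2 + 6 * ξ ^ 2) + 12 * κ₂ * σ * ε
          + 6 * K * L * (T' - r)) * (T' - r)
        = K * (2 * X r 3 ^ 2 + 6 * δ ^ 2) * (T' - r) + 6 * K * ξ ^ 2 * (T' - r)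
          + 12 * κ₂ * σ * ε * (T' - r) + 6 * K * L * (T' - r) * (T' - r) := by ring
    linarith only [e1, e2.le, hB6, hB7, hB8, hdrift]
  -- the sum
  have hK9 : (0 : ℝ) < K ^ 9 := by positivity
  have hsum : X T' 4 - X r 4 ≤ (0.056 + 32 * X r 3 ^ 2 * log K + 0.0015
      + (157 / 100 * X r 0 ^ 2 + 333 / 100 * W + 0.0005) + 0.183
      + (482 * X r 3 ^ 2 + 1446 * δ ^ 2) * log K + 0.001 + 0.001 + 0.0015) / K ^ 9 := by
    have e : (0.056 + 32 * X r 3 ^ 2 * log K + 0.0015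
        + (157 / 100 * X r 0 ^ 2 + 333 / 100 * W + 0.0005) + 0.183
        + (482 * X r 3 ^ 2 + 1446 * δ ^ 2) * log K + 0.001 + 0.001 + 0.0015) / K ^ 9
        = 0.056 / K ^ 9 + 32 * X r 3 ^ 2 * log K / K ^ 9 + 0.0015 / K ^ 9
          + (157 / 100 * X r 0 ^ 2 + 333 / 100 * W + 0.0005) / K ^ 9 + 0.183 / K ^ 9
          + ((482 * X r 3 ^ 2 + 1446 * δ ^ 2) * log K / K ^ 9 + 0.001 / K ^ 9
            + 0.001 / K ^ 9 + 0.0015 / K ^ 9) := by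
      field_simp
      ring
    rw [e]
    linarith only [hΔ1, hΔ2, hΔ3, hB1, hB2, hB3, hB4, hB5, hfall]
  refine hsum.trans (div_le_div_of_nonneg_right ?_ hK9.le)
  rw [hW]
  nlinarith only [hlogK, hd0, sq_nonneg δ, mul_nonneg hd0 hlogK, mul_nonneg (sq_nonneg δ) hlogK,
    sq_nonneg (X r 0), abs_nonneg (X r 3)]

end Summit.NavierStokesRegularity.FluidComputer.GateBudget
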